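import Literature.Probability.LatticeModels.SixVertexPlanarSpectralRepresentation
import Literature.Probability.LatticeModels.SixVertexSpectralGFFLimit

/-!
# Theorem 53 for the planar six-vertex measure (DKLM 2026, Part II), with its external inputs as
# explicit hypotheses

H. Duminil-Copin, K. K. Kozlowski, P. Lammers, I. Manolescu, *Gaussian free field convergence of
the six-vertex model with `-1 ≤ Δ ≤ -1/2`*, arXiv:2603.06268 (2026) [DKLM2026SixVertexGFF]
(`paper:arxiv-2603.06268`, chunks p0024–p0025, p0036):

> **Theorem 53 (Limit of the spectral measures).** […] If `lim_L lim_δ Φ₂^{(δL;δ)} = σ₀² Ψ₂^GFF`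
> […] then `lim_L lim_δ μ_L^{(4δL)} = μ_GFF := ½(δ_{b-a}+δ_{b+a}) σ₀²/(2πa) 𝟙_{a>0} da db` […]
> (Lemma 34, Step 1) However, `μ_∞[{a=2}] = 0`. Indeed […] as `k` tends to infinity over the odd
> integers, `Φ₂(0,e₁,(k+1)e₁,(k+2)e₁) = -∫ a²(1-a)^k dμ_∞(a,b) → 4 μ_∞[{a=2}]`. But we know that
> the correlation functions on the left tend to zero, thanks to our regularity estimate.

For the planar slope-zero measure `P` of the statement file we chain
`SixVertexPlanarSpectralRepresentation.lean` (Lemma 32 for the plane: a vague sub-sequential limit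
`μ_∞` of the cylinder spectral measures represents the planar two-point function of two horizontal
pairs) with `SixVertexSpectralGFFLimit.lean` (Lemma 34 + the "simple exercise": identification of
every convergence-sequence limit with `μ_σ`, and the subsequence principle). The three inputs that
the paper takes from elsewhere enter as explicit hypotheses:

* `hRa`, `hRb` — the two displays of the cylinder regularity estimate, Corollary 18 (Part IV),
  feeding Lemma 30;
* `hdecay` — `Φ₂^P(0, e₁, (k+1)e₁, (k+2)e₁) → 0` (regularity estimate, used for `μ_∞{a=2} = 0`);
* `hGFF` — convergence of the rescaled planar two-point function of two horizontal pairs to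
  `σ² Ψ₂^GFF` (the hypothesis of Theorem 53, i.e. the outcome of Theorem 27's dichotomy).

Results: `null_two_of_tendsto_integral_chiDiscr_unit` (`μ_∞{a=2} = 0`, Lemma 34 Step 1),
`planarTwoPoint` (the planar two-point function of two horizontal pairs in lattice units),
**`IsPlanarSixVertexMeasure.planar_gffSpectralLimit`** — there is a vague sub-sequential limit
`μ_∞ ∈ 𝓜` of `(μ_{2(ℓ+1)})_ℓ` and every such limit produced by Lemma 32 rescales to the GFF
spectral measure: `μ_∞^{(δ_n)} → μ_σ` vaguely for all scales `δ_n → 0⁺`.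

## References

* H. Duminil-Copin, K. K. Kozlowski, P. Lammers, I. Manolescu, arXiv:2603.06268 (2026), Part II,
  Theorem 53, Lemma 34 (Step 1), Lemmas 30–32. [DKLM2026SixVertexGFF]
-/

noncomputable section

open MeasureTheory Set Filter Topology

namespace Literature.Probability.LatticeModels.SixVertex

variable {c C : ℝ}

/-! ## 1. `μ_∞{a = 2} = 0` from the decay of the two-point function of distant unit pairs -/

/-- `χ^discr_{(1,0,k,0,1,0)}(a,b) = -a²(1-a)^k`. [cite: DKLM2026SixVertexGFF, Part II, proof of Lemma 34, Step 1] -/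
theorem chiDiscr_unit (k : ℕ) (p : ℝ × ℝ) :
    chiDiscr 1 0 k 0 1 0 p = -((p.1 : ℂ) ^ 2 * (1 - (p.1 : ℂ)) ^ k) := by
  simp only [chiDiscr, Int.cast_zero, mul_zero, neg_zero, Complex.exp_zero, mul_one, pow_one]
  ring

/-- **Lemma 34, Step 1: `μ_∞{a=2} = 0`** for `μ_∞ ∈ 𝓜_{c,C}` with `μ_∞{a>2} = 0`, as soon as the
two-point function of two unit horizontal pairs at distance `k`, `-∫ a²(1-a)^k dμ_∞ = Φ(k)`, tends to
`0` (along odd `k` the integrand tends to `4·𝟙_{a=2}`).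
[cite: DKLM2026SixVertexGFF, Part II, proof of Lemma 34, Step 1] -/
theorem null_two_of_tendsto_integral_chiDiscr_unit {μinf : Measure (ℝ × ℝ)} (hμ : μinf ∈ dklmSpaceM c C)
    (h2' : μinf {p : ℝ × ℝ | 2 < p.1} = 0) {Φ : ℕ → ℝ}
    (hΦ : ∀ k : ℕ, 1 ≤ k → ((Φ k : ℝ) : ℂ) = ∫ p, chiDiscr 1 0 k 0 1 0 p ∂μinf) (hlim : Tendsto Φ atTop (𝓝 0)) :
    μinf {p : ℝ × ℝ | p.1 = 2} = 0 := by
  have hae2 : ∀ᵐ p ∂μinf, p.1 ≤ 2 := by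
    rw [ae_iff]
    simpa only [not_le] using h2'
  -- the odd subsequence of integrands and its limit `4·𝟙_{a=2}`
  set g : ℕ → ℝ × ℝ → ℂ := fun j p => chiDiscr 1 0 (2 * j + 1) 0 1 0 p with hg
  set f : ℝ × ℝ → ℂ := ({p : ℝ × ℝ | p.1 = 2} : Set (ℝ × ℝ)).indicator fun _ => (4 : ℂ) with hf
  have hmeasS : MeasurableSet {p : ℝ × ℝ | p.1 = 2} := measurableSet_eq_fun measurable_fst measurable_const
  have hdct : Tendsto (fun j => ∫ p, g j p ∂μinf) atTop (𝓝 (∫ p, f p ∂μinf)) := by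
    refine tendsto_integral_of_dominated_convergence (fun p : ℝ × ℝ => 8 * min p.1 p.1⁻¹)
      (fun j => Continuous.aestronglyMeasurable (by rw [hg]; unfold chiDiscr; fun_prop))
      (dklmSpaceM_integrable_min_inv hμ (by norm_num)) (fun j => ?_) ?_
    · filter_upwards [dklmSpaceM_ae_pos hμ, hae2] with p hp hp2
      rw [hg]
      simp only
      rw [chiDiscr_unit, norm_neg, norm_mul, norm_pow, norm_pow, Complex.norm_real, Real.norm_eq_abs, abs_of_pos hp,
        show (1 - (p.1 : ℂ)) = ((1 - p.1 : ℝ) : ℂ) by push_cast; ring, Complex.norm_real, Real.norm_eq_abs]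
      have h1 : |1 - p.1| ≤ 1 := by rw [abs_le]; constructor <;> linarith
      have h2 : |1 - p.1| ^ (2 * j + 1) ≤ 1 := pow_le_one₀ (abs_nonneg _) h1
      rcases le_or_gt p.1 1 with hp1 | hp1
      · rw [min_eq_left (hp1.trans (one_le_inv_iff₀.2 ⟨hp, hp1⟩))]
        calc p.1 ^ 2 * |1 - p.1| ^ (2 * j + 1) ≤ p.1 ^ 2 * 1 := by gcongr
          _ ≤ 8 * p.1 := by nlinarith
      · rw [min_eq_right ((inv_le_one_of_one_le₀ hp1.le).trans hp1.le)]
        rw [show (8 : ℝ) * p.1⁻¹ = 8 / p.1 by ring, le_div_iff₀ hp]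
        calc p.1 ^ 2 * |1 - p.1| ^ (2 * j + 1) * p.1 ≤ p.1 ^ 2 * 1 * p.1 := by gcongr
          _ ≤ 8 := by nlinarith
    · filter_upwards [dklmSpaceM_ae_pos hμ, hae2] with p hp hp2
      rw [hf]
      by_cases h2 : p.1 = 2
      · rw [indicator_of_mem (show p ∈ {p : ℝ × ℝ | p.1 = 2} from h2)]
        have : ∀ j, g j p = 4 := by
          intro j
          rw [hg]
          simp only
          rw [chiDiscr_unit, h2]
          push_cast
          rw [show (1 - 2 : ℂ) = -1 by norm_num, Odd.neg_one_pow ⟨j, rfl⟩]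
          norm_num
        simp only [this]
        exact tendsto_const_nhds
      · rw [indicator_of_notMem (show p ∉ {p : ℝ × ℝ | p.1 = 2} from h2)]
        have hlt2 : p.1 < 2 := lt_of_le_of_ne hp2 h2
        have hlt : |1 - p.1| < 1 := by
          rw [abs_lt]; constructor <;> linarith
        have hpow : Tendsto (fun j : ℕ => (1 - (p.1 : ℂ)) ^ (2 * j + 1)) atTop (𝓝 0) := by
          have h0 := tendsto_pow_atTop_nhds_zero_of_norm_lt_one (show ‖(1 - (p.1 : ℂ))‖ < 1 by
            rw [show (1 - (p.1 : ℂ)) = ((1 - p.1 : ℝ) : ℂ) by push_cast; ring, Complex.norm_real, Real.norm_eq_abs]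
            exact hlt)
          exact h0.comp (by
            refine tendsto_atTop_atTop.2 fun b => ⟨b, fun a ha => by omega⟩)
        have := (hpow.const_mul ((p.1 : ℂ) ^ 2)).neg
        rw [mul_zero, neg_zero] at this
        refine this.congr fun j => ?_
        rw [hg]
        simp only
        rw [chiDiscr_unit]
  -- the same integrals are `Φ(2j+1) → 0`
  have hdct' : Tendsto (fun j => ∫ p, g j p ∂μinf) atTop (𝓝 0) := by
    have h1 : Tendsto (fun j => ((Φ (2 * j + 1) : ℝ) : ℂ)) atTop (𝓝 0) := by
      have := (Complex.continuous_ofReal.tendsto 0).comp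
        (hlim.comp (tendsto_atTop_atTop.2 fun b => ⟨b, fun a ha => by omega⟩ : Tendsto (fun j => 2 * j + 1) atTop atTop))
      rw [Complex.ofReal_zero] at this
      exact this
    refine h1.congr fun j => ?_
    rw [hg]
    exact hΦ (2 * j + 1) (by omega)
  have hint : ∫ p, f p ∂μinf = 0 := tendsto_nhds_unique hdct hdct'
  rw [hf, integral_indicator_const _ hmeasS, Complex.real_smul, mul_eq_zero] at hint
  rcases hint with h | h
  · -- `μ.real {a=2} = 0` and `μ {a=2} < ⊤`
    have hfin : μinf {p : ℝ × ℝ | p.1 = 2} ≠ ⊤ := by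
      have hsub : {p : ℝ × ℝ | p.1 = 2} ⊆ {p : ℝ × ℝ | p.1 ∈ Ioo (3 / 2 : ℝ) (2 * (3 / 2))} := by
        intro p hp
        have hp' : p.1 = 2 := hp
        show p.1 ∈ Ioo (3 / 2 : ℝ) (2 * (3 / 2))
        rw [hp']; constructor <;> norm_num
      exact ne_top_of_le_ne_top ENNReal.ofReal_ne_top ((measure_mono hsub).trans
        (dklmSpaceM_bound_i hμ (show (0 : ℝ) < 3 / 2 by norm_num)))
    exact (measureReal_eq_zero_iff hfin).1 (Complex.ofReal_eq_zero.1 h)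
  · norm_num at h

/-! ## 2. Theorem 53 for the planar measure -/

/-- **The planar two-point function of two horizontal pairs in lattice units**:
`Φ₂^P(x₁, x₁', y₁', x₂) = 𝔼_P[(h(u₁')-h(u₁))(h(u₂')-h(u₂))]` with `u₁' - u₁ = (x₁, 0)`, `u₂ - u₁' = (x₁', y₁')`,
`u₂' - u₂ = (x₂, 0)` (realised by `lPairConfig` with `y₀ = (y₁')⁻`, `y₂ = (y₁')⁺`).
[cite: DKLM2026SixVertexGFF, Def. 2.4] -/
def planarTwoPoint (P : Measure (Config (ℤ × ℤ))) (x₁ x₁' : ℕ) (y₁' : ℤ) (x₂ : ℕ) : ℝ :=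
  kPoint P 2 (lPairConfig (x₁ - 1) 0 (x₁ - 1) 0 0 (x₂ - 1) 0 (-y₁').toNat y₁'.toNat x₁')

/-- **Theorem 53 for the planar slope-zero six-vertex measure**, with the paper's external inputs
as hypotheses. Let `P` be the planar measure (`a = b = 1`, `c > 0`) and assume: the cylinder
regularity displays of Corollary 18 with constants `C_reg`, `c_reg > 0` (`hRa`, `hRb`); the decay
`Φ₂^P(0,e₁,(k+1)e₁,(k+2)e₁) → 0` (`hdecay`, regularity estimate); and the convergence of the rescaled
planar two-point function of two horizontal pairs to `σ² Ψ₂^GFF` along every sequence of scales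
(`hGFF`). Then there are a subsequence `L_j = 2(φ(j)+1)` and `μ_∞ ∈ 𝓜_{c_reg,C'}` with
`μ_{L_j} → μ_∞` vaguely, and **`μ_∞^{(δ_n)} → μ_σ = ½(δ_{b=a}+δ_{b=-a}) ⊗ σ²/(2πa) 𝟙_{a>0} da`
vaguely for every sequence of scales `δ_n → 0⁺`**.
[cite: DKLM2026SixVertexGFF, Part II, Theorem 53 (with Lemmas 30–32, 34 and §1.1)] -/
theorem IsPlanarSixVertexMeasure.planar_gffSpectralLimit (hc : 0 < c) {P : Measure (Config (ℤ × ℤ))}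
    (hP : IsPlanarSixVertexMeasure 1 1 c P) {Creg creg : ℝ} (hcreg : 0 < creg)
    (hRa : ∀ ℓ m : ℕ, |phiHor c ℓ m| ≤ Creg)
    (hRb : ∀ ℓ m ℓ' : ℕ, 0 < ℓ' → (ℓ' : ℝ) ≤ 8 * ((m : ℝ) + 1) → ℓ' ≤ ℓ + 1 →
      |phiVer c ℓ m ℓ'| ≤ Creg * ((ℓ' : ℝ) / ((m : ℝ) + 1)) ^ creg)
    (hdecay : Tendsto (fun k : ℕ => planarTwoPoint P 1 k 0 1) atTop (𝓝 0)) (σ : ℝ)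
    (hGFF : ∀ (δ : ℕ → ℝ), (∀ n, 0 < δ n) → Tendsto δ atTop (𝓝 0) →
      ∀ (m : ℕ) (x₁' y₁' x₂ : ℝ), 0 < x₁' → 0 < x₂ →
        Tendsto (fun n => planarTwoPoint P ⌈((m : ℝ) + 1) / δ n⌉₊ ⌈x₁' / δ n⌉₊ ⌊y₁' / δ n⌋ ⌈x₂ / δ n⌉₊) atTop
          (𝓝 (σ ^ 2 * gffKPoint 2 (configOf (m + 1) 0 x₁' y₁' x₂ 0)))) :
    ∃ (φ : ℕ → ℕ) (μinf : Measure (ℝ × ℝ)), StrictMono φ ∧ μinf ∈ dklmSpaceM creg (dklmRegConst Creg creg) ∧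
      HalfPlaneVagueTendsto (fun j => dklmMeasure c hc (φ j)) μinf ∧
      ∀ (δ' : ℕ → ℝ), (∀ n, 0 < δ' n) → Tendsto δ' atTop (𝓝 0) →
        HalfPlaneVagueTendsto (fun n => scaleMeasure (δ' n) μinf) (gffSpectralMeasure σ) := by
  obtain ⟨φ, μinf, hφ, hμinf, hv, h2', hrep, -⟩ := hP.exists_fullPlane_spectralMeasure hc hcreg hRa hRb
  have hC := dklmRegConst_nonneg Creg creg
  -- the representation of the two-point function of two horizontal pairs
  have hrep' : ∀ (x₁ x₁' : ℕ) (y₁' : ℤ) (x₂ : ℕ), 1 ≤ x₁ → 1 ≤ x₁' → 1 ≤ x₂ →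
      ((planarTwoPoint P x₁ x₁' y₁' x₂ : ℝ) : ℂ) = ∫ p, chiDiscr x₁ 0 x₁' y₁' x₂ 0 p ∂μinf := by
    intro x₁ x₁' y₁' x₂ hx₁ hx₁' hx₂
    have h := hrep (x₁ - 1) (x₂ - 1) 0 (x₁ - 1) (by omega) 0 (x₂ - 1) (by omega) 0 (-y₁').toNat y₁'.toNat x₁' (by omega)
    rw [planarTwoPoint, h]
    have e1 : x₁ - 1 + 1 = x₁ := Nat.sub_add_cancel hx₁
    have e2 : x₁ - 1 - 0 - (x₁ - 1) + x₁' + 0 = x₁' := by omega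
    have e3 : x₂ - 1 + 1 = x₂ := Nat.sub_add_cancel hx₂
    have e4 : ((y₁'.toNat : ℕ) : ℤ) - ((-y₁').toNat : ℕ) = y₁' := Int.toNat_sub_toNat_neg y₁'
    rw [e1, e2, e3, e4, Nat.cast_zero]
  -- `μ_∞{a=2} = 0` (Lemma 34, Step 1) from the decay hypothesis
  have h2 : μinf {p : ℝ × ℝ | p.1 = 2} = 0 :=
    null_two_of_tendsto_integral_chiDiscr_unit hμinf h2' (Φ := fun k => planarTwoPoint P 1 k 0 1)
      (fun k hk => by simpa using hrep' 1 k 0 1 le_rfl hk le_rfl) hdecay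
  refine ⟨φ, μinf, hφ, hμinf, hv, fun δ' hδ' hδ'0 => ?_⟩
  exact halfPlaneVagueTendsto_gff_of_tendsto_twoPoint hcreg hC hμinf h2 h2' hrep' σ hGFF hδ' hδ'0

end Literature.Probability.LatticeModels.SixVertex

end
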